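import Summits.CriticalPhenomena.Ising3D.Control2DGFFChiral
import Mathlib.Tactic
import HarnessLib

/-!
# The free-boson vertex-operator witness, I: finite identities behind `k_2 · k_{2a}`, `(1-x)^{-q}`
and `x^{2q}(1-x)^{-q}` in `sl(2)` blocks
(cell `pub-ising3x`, seat controls-1 gen 36; NON-VACUITY of the 2D control's hypothesis classes WITH a
stress tensor, step 1 of 4 — CONTROL-ONLY)

HONEST FRAMING: lottery ticket; floor = tightest certified 3D Ising CFT bounds; no exact-solution
claim without a proof. CONTROL-ONLY (`d = 2`); nothing numerical is asserted here.

`Control2DNonVacuity` inhabits the class `IsUnitary ∧ SatisfiesCrossing s` of the 2D control with the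
generalised free field, which has NO quasi-primary at the stress-tensor location `(Δ, ℓ) = (2, 2)` and
scalar gap exactly `2s` (`= 1/4` at the control's column `s = 1/8`). The hypothesis classes of the OPE /
central-charge items (`OpeBound (1/8) (3/10) P`: scalar gap `≥ 3/10`; `CTwoSided`: a `(2,2)` component
with the Ward value) are therefore still un-inhabited in the kernel. Their natural elementary witness is the
two-dimensional FREE BOSON (`c = 1`): the vertex operator `O = √2 cos(α φ)` of dimension `Δ_O = s = α²`
(any `s > 0`) has the four-point function `𝒢(u,v) = ½ (v^{-s} + v^{s} + u^{2s} v^{-s})`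
(Di Francesco–Mathieu–Sénéchal §9.1: `⟨∏ V_{α_i}⟩ = ∏_{i<j} |z_{ij}|^{2 α_i α_j}` on neutral charge
assignments). Its global-block expansion needs three chiral (`sl(2)`) expansions:

* `(1-x)^{-q} = Σ_n α_n(q) k_{2n}(x)` — the `U(1)`-current family; `α_n(q) ≥ 0` has NO product closed
  form (`α_4 = q⁴/24 + q²/120`); positivity comes from `(1-x)^{-q} = exp(q k_2(x))` (`k_2 = -log(1-x)`)
  and the PRODUCT RULE `k_2 k_{2a} = Σ_k E_k(a) k_{2(a+1+2k)}`, `E_k(a) ≥ 0`;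
* `x^{2q}(1-x)^{-q} = Σ_k γ_k(q) k_{4q+4k}(x)` — the charge-`2α` family,
  `γ_k(q) = (q)_k² / (4^k k! (2q+k-1/2)_k)`.

This file proves the FINITE (coefficient) identities behind both, by one method: the coefficient form of
the `sl(2)` Casimir `D = x²(1-x)∂² - x²∂` (`D k_{2h} = h(h-1) k_{2h}`; coefficientwise
`n(2h+n-1) κ_h(n) = (h+n-1)² κ_h(n-1)`, `κ_h(n) = (h)_n²/(n!(2h)_n) = chiralCoeff h n`) turns
"`f = Σ c_k k_{2h_k}`" into a first-order recursion for the power-series coefficients of `f` with a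
SOURCE term, which is then matched:

* `vtxC a k = (a)_{2k+1}/(16^k (a+1/2)_{2k})`, `vtxE a k = vtxC a k/((2k+1)(a+k))` (the product-rule
  coefficients, `≥ 0` for `a > 0`); `vtx_defect_sum` — the telescoping identity
  `Σ_{2k ≤ m} vtxC a k · κ_{a+1+2k}(m-2k) = (a+m) κ_a(m)` (coefficient form of `2x² k_{2a}' = (D - a(a-1))(k_2 k_{2a})`);
* the matching of the two coefficient sequences (`vtxW_eq_vtxW'`) and the charge-two family
  (`vtxGamma`, `vtxY_eq_vtxWG`) follow in `Control2DVertexRecursion`; the series are summed in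
  `Control2DVertexChiral`.

Finite algebra only. All identities were pre-checked in
exact rational arithmetic (HOME/pub-ising3x-controls-1/KP21/sym/verify_all.py).

References: Ph. Di Francesco, P. Mathieu, D. Sénéchal, Conformal Field Theory (Springer 1997), §9.1
[cite: DiFrancescoMathieuSenechal1997, §9.1]; F. A. Dolan, H. Osborn, arXiv:1108.6194, §2 eq. (2.11), §4
eq. (4.5) (the `sl(2)` Casimir and `κ_h`) [cite: DolanOsborn2011, §2 eq. (2.11)]. Tree: `chiralCoeff`,
`chiralCoeff_eq_poch` (`Control2DTermwise`, `Control2DGFFChiral`), `poch` + lemmas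
(`Literature/…/ConformalBootstrap3D/MeanFieldCoefficients`).
-/

namespace Summit.CriticalPhenomena.Ising3D.Control2D

open Finset
open Literature.MathematicalPhysics.QuantumFieldTheory.ConformalBootstrap3D

/-! ### Pochhammer bookkeeping -/

/-- Duplication: `(2c)_{2n} = 4^n (c)_n (c + 1/2)_n`. [folklore] -/
theorem poch_two_mul_two_mul (c : ℝ) (n : ℕ) :
    poch (2 * c) (2 * n) = 4 ^ n * poch c n * poch (c + 1 / 2) n := by
  induction n with
  | zero => simp
  | succ n ih =>
    rw [show 2 * (n + 1) = 2 * n + 1 + 1 by ring, poch_succ, poch_succ, ih, poch_succ, poch_succ]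
    push_cast
    ring

/-- The hypergeometric ratio of the chiral block coefficients:
`(n+1)(2h+n) κ_h(n+1) = (h+n)² κ_h(n)` (`h > 0`) — the coefficient form of `D k_{2h} = h(h-1) k_{2h}`.
[cite: DolanOsborn2011, §2 eq. (2.11)] -/
theorem chiralCoeff_succ_rec {h : ℝ} (hh : 0 < h) (n : ℕ) :
    ((n : ℝ) + 1) * (2 * h + n) * chiralCoeff h (n + 1) = (h + n) ^ 2 * chiralCoeff h n := by
  rw [chiralCoeff_eq_poch, chiralCoeff_eq_poch, poch_succ, poch_succ, Nat.factorial_succ]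
  have h1 : (n.factorial : ℝ) ≠ 0 := by positivity
  have h2 : poch (2 * h) n ≠ 0 := poch_ne_zero (by linarith) n
  have h3 : (2 * h + n) ≠ 0 := by positivity
  have h4 : ((n : ℝ) + 1) ≠ 0 := by positivity
  rw [mul_div_assoc', mul_div_assoc', div_eq_div_iff (by push_cast; positivity) (by positivity)]
  push_cast
  ring

/-- `κ_h(0) = 1`. [folklore] -/
@[simp] theorem chiralCoeff_zero_right (h : ℝ) : chiralCoeff h 0 = 1 := by
  rw [chiralCoeff_eq_poch]; simp

/-- `κ_h(1) = h/2` (`h > 0`). [folklore] -/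
theorem chiralCoeff_one_right {h : ℝ} (hh : 0 < h) : chiralCoeff h 1 = h / 2 := by
  rw [chiralCoeff_eq_poch, poch_one, poch_one, Nat.factorial_one, Nat.cast_one, one_mul]
  have : h ≠ 0 := hh.ne'
  rw [div_eq_div_iff (by positivity) two_ne_zero]
  ring

/-- The coefficients of `k_2(x) = -log(1-x) = Σ_m x^{m+1}/(m+1)`: `κ_1(m) = 1/(m+1)`. [folklore] -/
theorem chiralCoeff_one_left (m : ℕ) : chiralCoeff 1 m = 1 / ((m : ℝ) + 1) := by
  rw [chiralCoeff_eq_poch, poch_one_left, show (2 : ℝ) * 1 = 1 + 1 by ring]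
  have h := poch_succ_nat_mul_factorial 1 m
  rw [Nat.cast_one, Nat.factorial_one, Nat.cast_one, mul_one] at h
  rw [h, show 1 + m = m + 1 by ring, Nat.factorial_succ]
  have h1 : (m.factorial : ℝ) ≠ 0 := by positivity
  rw [div_eq_div_iff (by push_cast; positivity) (by positivity)]
  push_cast
  ring

/-! ### The product-rule coefficients `E_k(a)` of `k_2 · k_{2a} = Σ_k E_k(a) k_{2(a+1+2k)}` -/

/-- `c_k(a) = (a)_{2k+1} / (16^k (a + 1/2)_{2k})`: the coefficient of `k_{2(a+1+2k)}` in `2x² k_{2a}'(x)`.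
[folklore] -/
noncomputable def vtxC (a : ℝ) (k : ℕ) : ℝ :=
  poch a (2 * k + 1) / (16 ^ k * poch (a + 1 / 2) (2 * k))

/-- `E_k(a) = c_k(a) / ((2k+1)(a+k))`: the coefficient of `k_{2(a+1+2k)}(x)` in the product
`k_2(x) k_{2a}(x)` (`= (1/2)_k (a)_k (a+k+1)_k / (k! 16^k (a+1/2)_k (3/2)_k (a+k+1/2)_k)`). [folklore] -/
noncomputable def vtxE (a : ℝ) (k : ℕ) : ℝ :=
  vtxC a k / ((2 * k + 1) * (a + k))

/-- `c_k(a) > 0` for `a > 0`. [folklore] -/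
theorem vtxC_pos {a : ℝ} (ha : 0 < a) (k : ℕ) : 0 < vtxC a k := by
  unfold vtxC
  have h1 := poch_pos ha (2 * k + 1)
  have h2 := poch_pos (by linarith : 0 < a + 1 / 2) (2 * k)
  positivity

/-- `E_k(a) > 0` for `a > 0`. [folklore] -/
theorem vtxE_pos {a : ℝ} (ha : 0 < a) (k : ℕ) : 0 < vtxE a k := by
  unfold vtxE
  have h1 := vtxC_pos ha k
  positivity

/-- `E_k(a) ≥ 0` for `a > 0`. [folklore] -/
theorem vtxE_nonneg {a : ℝ} (ha : 0 < a) (k : ℕ) : 0 ≤ vtxE a k := (vtxE_pos ha k).le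

/-- `E_0(a) = 1` (`a > 0`): the leading term `k_2 k_{2a} = k_{2a+2} + …`. [folklore] -/
theorem vtxE_zero {a : ℝ} (ha : 0 < a) : vtxE a 0 = 1 := by
  unfold vtxE vtxC
  have : a ≠ 0 := ha.ne'
  simp only [Nat.cast_zero, mul_zero, zero_add, pow_zero, poch_one, poch_zero, one_mul, mul_one, add_zero]
  field_simp

/-- `(2k+1)(a+k) E_k(a) = c_k(a)` (`a > 0`). [folklore] -/
theorem vtxE_mul {a : ℝ} (ha : 0 < a) (k : ℕ) : (2 * (k : ℝ) + 1) * (a + k) * vtxE a k = vtxC a k := by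
  unfold vtxE
  have h1 : (2 * (k : ℝ) + 1) * (a + k) ≠ 0 := by positivity
  field_simp

/-! ### The telescoping identity (coefficient form of `2x² k_{2a}' = (D - a(a-1))(k_2 k_{2a})`) -/

/-- The telescoping potential `Q(k, n) = (a)_{2k}² (a+2k)² (a+1+2k)_n² / ((a+n+2k) n! (2a)_{n+4k})`.
[folklore] -/
noncomputable def vtxQ (a : ℝ) (k n : ℕ) : ℝ :=
  poch a (2 * k) ^ 2 * (a + 2 * k) ^ 2 * poch (a + 1 + 2 * k) n ^ 2 /
    ((a + n + 2 * k) * n.factorial * poch (2 * a) (n + 4 * k))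

/-- `Q(0, m) = (a + m) κ_a(m)`. [folklore] -/
theorem vtxQ_zero_left {a : ℝ} (ha : 0 < a) (m : ℕ) : vtxQ a 0 m = (a + m) * chiralCoeff a m := by
  have e1 : a * poch (a + 1) m = poch a m * (a + m) := by
    rw [← poch_succ, poch_succ_left]
  have h1 : (m.factorial : ℝ) ≠ 0 := by positivity
  have h2 : poch (2 * a) m ≠ 0 := poch_ne_zero (by linarith) m
  have h3 : a + m ≠ 0 := by positivity
  have e3 : poch (a + 1) m = poch a m * (a + m) / a := by
    rw [eq_div_iff ha.ne']
    linarith [e1]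
  unfold vtxQ
  rw [chiralCoeff_eq_poch]
  simp only [Nat.cast_zero, mul_zero, add_zero, poch_zero, one_pow, one_mul]
  rw [e3]
  field_simp

/-- `(2a)_{4k} = 16^k (a)_{2k} (a + 1/2)_{2k}`. [folklore] -/
theorem poch_two_mul_four_mul (a : ℝ) (k : ℕ) :
    poch (2 * a) (4 * k) = 16 ^ k * poch a (2 * k) * poch (a + 1 / 2) (2 * k) := by
  rw [show 4 * k = 2 * (2 * k) by ring, poch_two_mul_two_mul, pow_mul]
  norm_num

/-- The last telescoping step, even case: `c_k(a) κ_{a+1+2k}(0) = Q(k, 0)`. [folklore] -/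
theorem vtxQ_last_zero {a : ℝ} (ha : 0 < a) (k : ℕ) :
    vtxC a k * chiralCoeff (a + 1 + 2 * k) 0 = vtxQ a k 0 := by
  have eP : poch a (2 * k + 1) = poch a (2 * k) * (a + 2 * k) := by
    rw [poch_succ]; push_cast; ring
  unfold vtxC vtxQ
  rw [chiralCoeff_zero_right, eP, zero_add, poch_two_mul_four_mul]
  have h1 : poch a (2 * k) ≠ 0 := poch_ne_zero ha _
  have h2 : poch (a + 1 / 2) (2 * k) ≠ 0 := poch_ne_zero (by linarith) _
  have h3 : a + 2 * k ≠ 0 := by positivity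
  simp only [poch_zero, Nat.factorial_zero, Nat.cast_zero, Nat.cast_one, add_zero, one_pow, mul_one]
  field_simp

/-- The last telescoping step, odd case: `c_k(a) κ_{a+1+2k}(1) = Q(k, 1)`. [folklore] -/
theorem vtxQ_last_one {a : ℝ} (ha : 0 < a) (k : ℕ) :
    vtxC a k * chiralCoeff (a + 1 + 2 * k) 1 = vtxQ a k 1 := by
  have eP : poch a (2 * k + 1) = poch a (2 * k) * (a + 2 * k) := by
    rw [poch_succ]; push_cast; ring
  have e41 : poch (2 * a) (1 + 4 * k) =
      16 ^ k * poch a (2 * k) * poch (a + 1 / 2) (2 * k) * (2 * a + 4 * k) := by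
    rw [show 1 + 4 * k = 4 * k + 1 by ring, poch_succ, poch_two_mul_four_mul]
    push_cast
    ring
  unfold vtxC vtxQ
  rw [chiralCoeff_one_right (by positivity), eP, e41, poch_one]
  have h1 : poch a (2 * k) ≠ 0 := poch_ne_zero ha _
  have h2 : poch (a + 1 / 2) (2 * k) ≠ 0 := poch_ne_zero (by linarith) _
  have h3 : a + 2 * k ≠ 0 := by positivity
  have h4 : a + 1 + 2 * k ≠ 0 := by positivity
  have h5 : 2 * a + 4 * k ≠ 0 := by positivity
  simp only [Nat.factorial_one, Nat.cast_one, mul_one]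
  field_simp
  ring

/-- The generic telescoping step: `c_k(a) κ_{a+1+2k}(n+2) = Q(k, n+2) - Q(k+1, n)`. [folklore] -/
theorem vtxQ_step {a : ℝ} (ha : 0 < a) (k n : ℕ) :
    vtxC a k * chiralCoeff (a + 1 + 2 * k) (n + 2) = vtxQ a k (n + 2) - vtxQ a (k + 1) n := by
  -- atoms: X = (a)_{2k}, Y = (a+1/2)_{2k}, U = (a+1+2(k+1))_n, D = (2a)_{n+2+4k}
  have eP : poch a (2 * k + 1) = poch a (2 * k) * (a + 2 * k) := by
    rw [poch_succ]; push_cast; ring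
  have eX2 : poch a (2 * (k + 1)) = poch a (2 * k) * (a + 2 * k) * (a + 2 * k + 1) := by
    rw [show 2 * (k + 1) = 2 * k + 1 + 1 by ring, poch_succ, poch_succ]; push_cast; ring
  have eU : poch (a + 1 + 2 * k) (n + 2) =
      (a + 1 + 2 * k) * (a + 2 + 2 * k) * poch (a + 1 + 2 * (k + 1 : ℕ)) n := by
    rw [show n + 2 = n + 1 + 1 by ring, poch_succ_left, poch_succ_left]
    have : a + 1 + 2 * (k : ℝ) + 1 + 1 = a + 1 + 2 * ((k + 1 : ℕ) : ℝ) := by push_cast; ring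
    rw [this]
    ring
  have eV : poch (2 * a) (n + 4 * (k + 1)) = poch (2 * a) (4 * k + 2) * poch (2 * (a + 1 + 2 * k)) (n + 2) := by
    rw [show n + 4 * (k + 1) = (4 * k + 2) + (n + 2) by ring, poch_add (2 * a) (4 * k + 2) (n + 2)]
    congr 1
    congr 1
    push_cast
    ring
  have eD : poch (2 * a) (n + 4 * (k + 1)) =
      poch (2 * a) (n + 2 + 4 * k) * (2 * a + n + 4 * k + 2) * (2 * a + n + 4 * k + 3) := by
    rw [show n + 4 * (k + 1) = n + 2 + 4 * k + 1 + 1 by ring, poch_succ, poch_succ]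
    push_cast
    ring
  have e42 : poch (2 * a) (4 * k + 2) =
      16 ^ k * poch a (2 * k) * poch (a + 1 / 2) (2 * k) * (2 * a + 4 * k) * (2 * a + 4 * k + 1) := by
    rw [poch_succ, poch_succ, poch_two_mul_four_mul]
    push_cast
    ring
  have hX : poch a (2 * k) ≠ 0 := poch_ne_zero ha _
  have hY : poch (a + 1 / 2) (2 * k) ≠ 0 := poch_ne_zero (by linarith) _
  have hD : poch (2 * a) (n + 2 + 4 * k) ≠ 0 := poch_ne_zero (by linarith) _
  have hn : ((n + 2).factorial : ℝ) = (n + 2) * (n + 1) * n.factorial := by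
    rw [Nat.factorial_succ, Nat.factorial_succ]; push_cast; ring
  have h1 : (n.factorial : ℝ) ≠ 0 := by positivity
  have h6 : a + 2 * k ≠ 0 := by positivity
  have h7 : 2 * a + 4 * k ≠ 0 := by positivity
  have h8 : 2 * a + 4 * k + 1 ≠ 0 := by positivity
  have h9 : 2 * a + n + 4 * k + 2 ≠ 0 := by positivity
  have h10 : 2 * a + n + 4 * k + 3 ≠ 0 := by positivity
  have h11 : a + ((n : ℝ) + 2) + 2 * k ≠ 0 := by positivity
  have h12 : a + n + 2 * ((k : ℝ) + 1) ≠ 0 := by positivity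
  have h13 : a + 1 + 2 * k ≠ 0 := by positivity
  have h14 : a + 2 + 2 * k ≠ 0 := by positivity
  have h15 : (n : ℝ) + 2 ≠ 0 := by positivity
  have h16 : (n : ℝ) + 1 ≠ 0 := by positivity
  have h17 : (16 : ℝ) ^ k ≠ 0 := by positivity
  have h18 : a + 2 * k + 1 ≠ 0 := by positivity
  have h19 : a + 2 * ((k : ℝ) + 1) ≠ 0 := by positivity
  have hU : poch (a + 1 + 2 * ((k + 1 : ℕ) : ℝ)) n ≠ 0 := poch_ne_zero (by positivity) _
  have eV' : poch (2 * (a + 1 + 2 * k)) (n + 2) =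
      poch (2 * a) (n + 2 + 4 * k) * (2 * a + n + 4 * k + 2) * (2 * a + n + 4 * k + 3) /
        (16 ^ k * poch a (2 * k) * poch (a + 1 / 2) (2 * k) * (2 * a + 4 * k) * (2 * a + 4 * k + 1)) := by
    have h := eV
    rw [eD, e42] at h
    rw [eq_div_iff (by positivity)]
    linarith [h]
  unfold vtxC vtxQ
  rw [chiralCoeff_eq_poch, eP, eU, eV', eX2, eD, hn]
  generalize poch a (2 * k) = X at hX ⊢
  generalize poch (a + 1 / 2) (2 * k) = Y at hY ⊢
  generalize poch (a + 1 + 2 * ((k + 1 : ℕ) : ℝ)) n = U at hU ⊢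
  generalize poch (2 * a) (n + 2 + 4 * k) = D at hD ⊢
  push_cast
  field_simp
  ring

/-- **The telescoped sum** (coefficient form of `2x² k_{2a}'(x) = Σ_k 2 c_k(a) k_{2(a+1+2k)}(x)`):
`Σ_{k ≤ m/2} c_k(a) κ_{a+1+2k}(m - 2k) = (a + m) κ_a(m)` for `a > 0`. [folklore] -/
theorem vtx_defect_sum {a : ℝ} (ha : 0 < a) (m : ℕ) :
    ∑ k ∈ range (m + 1), (if 2 * k ≤ m then vtxC a k * chiralCoeff (a + 1 + 2 * k) (m - 2 * k) else 0)
      = (a + m) * chiralCoeff a m := by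
  set f : ℕ → ℝ := fun k => if 2 * k ≤ m then vtxQ a k (m - 2 * k) else 0 with hf
  have hstep : ∀ k ∈ range (m + 1),
      (if 2 * k ≤ m then vtxC a k * chiralCoeff (a + 1 + 2 * k) (m - 2 * k) else 0) = f k - f (k + 1) := by
    intro k _
    by_cases h2 : 2 * k + 2 ≤ m
    · have h0 : 2 * k ≤ m := by omega
      have h1 : 2 * (k + 1) ≤ m := by omega
      obtain ⟨n, hn⟩ : ∃ n, m - 2 * k = n + 2 := ⟨m - 2 * k - 2, by omega⟩
      have hn' : m - 2 * (k + 1) = n := by omega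
      simp only [hf, if_pos h0, if_pos h1, hn, hn']
      exact vtxQ_step ha k n
    · by_cases h0 : 2 * k ≤ m
      · have h1 : ¬ 2 * (k + 1) ≤ m := by omega
        simp only [hf, if_pos h0, if_neg h1, sub_zero]
        obtain ⟨j, hj⟩ : ∃ j, m - 2 * k = j := ⟨_, rfl⟩
        have hj2 : j < 2 := by omega
        rw [hj]
        interval_cases j
        · exact vtxQ_last_zero ha k
        · exact vtxQ_last_one ha k
      · have h1 : ¬ 2 * (k + 1) ≤ m := by omega
        simp only [hf, if_neg h0, if_neg h1, sub_zero]
  have hf0 : f 0 = (a + m) * chiralCoeff a m := by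
    simp only [hf, mul_zero, Nat.zero_le, if_true, Nat.sub_zero]
    exact vtxQ_zero_left ha m
  have hfm : f (m + 1) = 0 := by
    simp only [hf]
    rw [if_neg (by omega)]
  rw [sum_congr rfl hstep, sum_range_sub', hf0, hfm, sub_zero]

end Summit.CriticalPhenomena.Ising3D.Control2D
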